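import Mathlib

/-!
# T5ClopenCosets — in a compact group every clopen set is a finite disjoint union of cosets of an
  open subgroup: the «open cosets» of CHECK-G §3 S4 are the clopen sets

Tier-5 support of seat p7 (route/T5-CHECK-G-p7.md §3 S4 «indicators of open cosets span …», S1 / S4
«inf over opens»; route/T5-LEAN-p7.md §57).  T5LocallyConstantDense / T5MeasureSupOnClopens /
T5MuInvariantPadic work with CLOPEN sets; the prose speaks of «open cosets» (cosets of open
subgroups of the profinite group `Γ⁻`) and of «opens» (for a measure: compact opens).  This file
identifies the two vocabularies on a compact topological group `G`:

* `isClopen_smul` — every coset `x • H` of an open subgroup is clopen;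
* `exists_openSubgroup_smul_subset` — a clopen `U ∋ x` contains the coset `x • H` of an open
  subgroup (Mathlib's `IsTopologicalGroup.exist_openSubgroup_sub_clopen_nhds_of_one` on `x⁻¹ • U`);
* `exists_openSubgroup_forall_smul_subset` — ONE open subgroup `H` works for every `x ∈ U`
  (compactness of `U`, finite intersection of open subgroups);
* `exists_finset_eq_biUnion_smul` — **a clopen set is a finite union of pairwise distinct (hence
  disjoint) cosets `x • H`, `x ∈ U`, of an open subgroup `H`** (finitely many cosets because
  `G ⧸ H` is finite);
* `indicator_eq_sum_indicator_smul` — `1_U = ∑_{x ∈ s} 1_{x • H}` for such a decomposition, in any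
  additive monoid of values.

Mathlib only; nothing about measures is asserted here (the consequence for the μ-invariant —
`inf over clopens = inf over open cosets` — is T5MuInvariantPadic's vocabulary applied to the sum).
Axioms: standard.  README §8(d): uses an L-value-free non-vanishing device: NO.
-/

namespace Summit.Ventures.HodgeRepro2.T5ClopenCosets

open Set Pointwise

variable {G : Type*} [Group G] [TopologicalSpace G] [IsTopologicalGroup G]

/-- A coset `x • H` of an open subgroup is open. -/
theorem isOpen_smul (H : OpenSubgroup G) (x : G) : IsOpen (x • (H : Set G)) :=
  H.isOpen.smul x

/-- A coset `x • H` of an open subgroup is clopen. -/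
theorem isClopen_smul (H : OpenSubgroup G) (x : G) : IsClopen (x • (H : Set G)) :=
  ⟨H.isClopen.isClosed.smul x, H.isOpen.smul x⟩

/-- A translate of a clopen set is clopen. -/
theorem IsClopen.smul_left {U : Set G} (hU : IsClopen U) (x : G) : IsClopen (x • U) :=
  ⟨hU.isClosed.smul x, hU.isOpen.smul x⟩

omit [TopologicalSpace G] [IsTopologicalGroup G] in
/-- `x ∈ x • H`. -/
theorem mem_smul_self (H : Subgroup G) (x : G) : x ∈ x • (H : Set G) := by
  rw [mem_leftCoset_iff, inv_mul_cancel]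
  exact H.one_mem

variable [CompactSpace G]

/-- A clopen `U ∋ x` contains a coset `x • H` of an open subgroup `H`. -/
theorem exists_openSubgroup_smul_subset {U : Set G} (hU : IsClopen U) {x : G} (hx : x ∈ U) :
    ∃ H : OpenSubgroup G, x • (H : Set G) ⊆ U := by
  have hW : IsClopen (x⁻¹ • U) := IsClopen.smul_left hU x⁻¹
  have h1 : (1 : G) ∈ x⁻¹ • U := by
    rw [Set.mem_smul_set_iff_inv_smul_mem, inv_inv, smul_eq_mul, mul_one]
    exact hx
  obtain ⟨H, hH⟩ := IsTopologicalGroup.exist_openSubgroup_sub_clopen_nhds_of_one hW h1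
  refine ⟨H, fun y hy => ?_⟩
  rw [Set.mem_smul_set_iff_inv_smul_mem] at hy
  have := hH hy
  rw [Set.mem_smul_set_iff_inv_smul_mem, inv_inv] at this
  simpa using this

/-- The intersection of finitely many open subgroups, as an open subgroup. -/
def iInfOpenSubgroup {ι : Type*} (s : Finset ι) (H : ι → OpenSubgroup G) : OpenSubgroup G where
  toSubgroup := ⨅ i ∈ s, (H i : Subgroup G)
  isOpen' := by
    show IsOpen ((⨅ i ∈ s, (H i : Subgroup G) : Subgroup G) : Set G)
    have : ((⨅ i ∈ s, (H i : Subgroup G) : Subgroup G) : Set G) =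
        ⋂ i ∈ s, ((H i : Subgroup G) : Set G) := by
      simp only [Subgroup.coe_iInf]
    rw [this]
    exact isOpen_biInter_finset fun i _ => (H i).isOpen

omit [IsTopologicalGroup G] [CompactSpace G] in
/-- `⨅ H_i ≤ H_j` for `j ∈ s`. -/
theorem iInfOpenSubgroup_le {ι : Type*} (s : Finset ι) (H : ι → OpenSubgroup G) {j : ι}
    (hj : j ∈ s) : ((iInfOpenSubgroup s H : OpenSubgroup G) : Set G) ⊆ (H j : Set G) := by
  intro y hy
  have hy' : y ∈ (⨅ i ∈ s, (H i : Subgroup G) : Subgroup G) := hy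
  rw [Subgroup.mem_iInf] at hy'
  have := hy' j
  rw [Subgroup.mem_iInf] at this
  exact this hj

/-- **One open subgroup for the whole clopen set**: `x • H ⊆ U` for every `x ∈ U`. -/
theorem exists_openSubgroup_forall_smul_subset {U : Set G} (hU : IsClopen U) :
    ∃ H : OpenSubgroup G, ∀ x ∈ U, x • (H : Set G) ⊆ U := by
  classical
  have hx : ∀ x : U, ∃ H : OpenSubgroup G, (x : G) • (H : Set G) ⊆ U := fun x =>
    exists_openSubgroup_smul_subset hU x.2
  choose Hx hHx using hx
  have hcover : U ⊆ ⋃ x : U, (x : G) • ((Hx x : OpenSubgroup G) : Set G) := fun y hy =>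
    mem_iUnion.mpr ⟨⟨y, hy⟩, mem_smul_self _ y⟩
  obtain ⟨t, ht⟩ := hU.isClosed.isCompact.elim_finite_subcover
    (fun x : U => (x : G) • ((Hx x : OpenSubgroup G) : Set G))
    (fun x => isOpen_smul (Hx x) x) hcover
  refine ⟨iInfOpenSubgroup t Hx, fun x hxU => ?_⟩
  obtain ⟨z, hz, hxz⟩ := mem_iUnion₂.mp (ht hxU)
  intro y hy
  rw [mem_leftCoset_iff] at hy hxz
  have hy' : (z : G)⁻¹ * y ∈ ((Hx z : OpenSubgroup G) : Set G) := by
    have h1 : (z : G)⁻¹ * y = ((z : G)⁻¹ * x) * (x⁻¹ * y) := by group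
    rw [h1]
    exact (Hx z : Subgroup G).mul_mem hxz (iInfOpenSubgroup_le t Hx hz hy)
  exact hHx z ((mem_leftCoset_iff (z : G)).mpr hy')

/-- **A clopen set is a finite union of pairwise distinct cosets of an open subgroup**, with
representatives in the set: `U = ⋃_{x ∈ s} x • H`, `s ⊆ U` finite, `x • H = y • H → x = y` on `s`. -/
theorem exists_finset_eq_biUnion_smul {U : Set G} (hU : IsClopen U) :
    ∃ (H : OpenSubgroup G) (s : Finset G), (∀ x ∈ s, x ∈ U) ∧
      (∀ x ∈ s, ∀ y ∈ s, x • (H : Set G) = y • (H : Set G) → x = y) ∧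
      U = ⋃ x ∈ s, x • (H : Set G) := by
  classical
  obtain ⟨H, hH⟩ := exists_openSubgroup_forall_smul_subset hU
  -- the cosets meeting U are finitely many (G ⧸ H is finite); the representatives `Quotient.out`
  let Q : Set (G ⧸ (H : Subgroup G)) := QuotientGroup.mk '' U
  have hQ : Q.Finite := Set.toFinite Q
  let s : Finset G := hQ.toFinset.image Quotient.out
  have hout : ∀ u : G, (Quotient.out (QuotientGroup.mk u : G ⧸ (H : Subgroup G))) ∈
      u • (H : Set G) := by
    intro u
    obtain ⟨h, hh⟩ := QuotientGroup.mk_out_eq_mul (H : Subgroup G) u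
    rw [hh, mem_leftCoset_iff, inv_mul_cancel_left]
    exact h.2
  have hmem : ∀ x ∈ s, x ∈ U := by
    intro x hx
    obtain ⟨q, hq, rfl⟩ := Finset.mem_image.mp hx
    obtain ⟨u, hu, rfl⟩ := (Set.Finite.mem_toFinset hQ).mp hq
    exact hH u hu (hout u)
  have hpair : ∀ x ∈ s, ∀ y ∈ s, x • (H : Set G) = y • (H : Set G) → x = y := by
    intro x hx y hy hxy
    obtain ⟨q, _, rfl⟩ := Finset.mem_image.mp hx
    obtain ⟨q', _, rfl⟩ := Finset.mem_image.mp hy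
    have hxmem : Quotient.out q ∈ Quotient.out q' • (H : Set G) := by
      rw [← hxy]
      exact mem_smul_self _ _
    rw [mem_leftCoset_iff] at hxmem
    have hq : (QuotientGroup.mk (Quotient.out q') : G ⧸ (H : Subgroup G)) =
        QuotientGroup.mk (Quotient.out q) := QuotientGroup.eq.mpr hxmem
    rw [QuotientGroup.out_eq', QuotientGroup.out_eq'] at hq
    rw [hq]
  refine ⟨H, s, hmem, hpair, Set.Subset.antisymm ?_ ?_⟩
  · intro u hu
    have hq : (QuotientGroup.mk u : G ⧸ (H : Subgroup G)) ∈ Q := ⟨u, hu, rfl⟩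
    refine mem_iUnion₂.mpr ⟨Quotient.out (QuotientGroup.mk u : G ⧸ (H : Subgroup G)),
      Finset.mem_image.mpr ⟨_, (Set.Finite.mem_toFinset hQ).mpr hq, rfl⟩, ?_⟩
    -- u ∈ out (mk u) • H: both lie in the same coset
    have h1 := hout u
    rw [mem_leftCoset_iff] at h1 ⊢
    have : (Quotient.out (QuotientGroup.mk u : G ⧸ (H : Subgroup G)))⁻¹ * u =
        (u⁻¹ * Quotient.out (QuotientGroup.mk u : G ⧸ (H : Subgroup G)))⁻¹ := by group
    rw [this]
    exact (H : Subgroup G).inv_mem h1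
  · intro u hu
    obtain ⟨x, hx, hux⟩ := mem_iUnion₂.mp hu
    exact hH x (hmem x hx) hux

omit [TopologicalSpace G] [IsTopologicalGroup G] [CompactSpace G] in
/-- Two cosets of a subgroup are equal or disjoint. -/
theorem smul_eq_or_disjoint (H : Subgroup G) (x y : G) :
    x • (H : Set G) = y • (H : Set G) ∨ Disjoint (x • (H : Set G)) (y • (H : Set G)) := by
  by_cases h : x⁻¹ * y ∈ H
  · left
    ext z
    simp only [mem_leftCoset_iff]
    constructor
    · intro hz
      have : y⁻¹ * z = (x⁻¹ * y)⁻¹ * (x⁻¹ * z) := by group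
      rw [this]
      exact H.mul_mem (H.inv_mem h) hz
    · intro hz
      have : x⁻¹ * z = (x⁻¹ * y) * (y⁻¹ * z) := by group
      rw [this]
      exact H.mul_mem h hz
  · right
    rw [Set.disjoint_left]
    intro z hzx hzy
    rw [mem_leftCoset_iff] at hzx hzy
    apply h
    have : x⁻¹ * y = (x⁻¹ * z) * (y⁻¹ * z)⁻¹ := by group
    rw [this]
    exact H.mul_mem hzx (H.inv_mem hzy)

omit [TopologicalSpace G] [IsTopologicalGroup G] [CompactSpace G] in
/-- The indicator of a finite union of pairwise-distinct cosets is the sum of the indicators: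
`1_U = ∑_{x ∈ s} 1_{x • H}` when the `x • H`, `x ∈ s`, are pairwise distinct. -/
theorem indicator_eq_sum_indicator_smul {M : Type*} [AddCommMonoid M] (H : Subgroup G)
    (s : Finset G) (hs : ∀ x ∈ s, ∀ y ∈ s, x • (H : Set G) = y • (H : Set G) → x = y) (c : M)
    (z : G) : (⋃ x ∈ s, x • (H : Set G)).indicator (fun _ => c) z =
      ∑ x ∈ s, (x • (H : Set G)).indicator (fun _ => c) z := by
  classical
  by_cases hz : z ∈ ⋃ x ∈ s, x • (H : Set G)
  · obtain ⟨x₀, hx₀, hzx₀⟩ := mem_iUnion₂.mp hz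
    rw [indicator_of_mem hz, Finset.sum_eq_single x₀]
    · rw [indicator_of_mem hzx₀]
    · intro y hy hyx
      apply indicator_of_notMem
      intro hzy
      rcases smul_eq_or_disjoint H y x₀ with h | h
      · exact hyx (hs y hy x₀ hx₀ h)
      · exact Set.disjoint_left.mp h hzy hzx₀
    · intro h
      exact absurd hx₀ h
  · rw [indicator_of_notMem hz]
    symm
    apply Finset.sum_eq_zero
    intro x hx
    apply indicator_of_notMem
    intro hzx
    exact hz (mem_iUnion₂.mpr ⟨x, hx, hzx⟩)

/-- **S4's vocabulary**: the indicator of a clopen set is a finite sum of indicators of cosets of an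
open subgroup. -/
theorem exists_indicator_eq_sum {M : Type*} [AddCommMonoid M] {U : Set G} (hU : IsClopen U)
    (c : M) : ∃ (H : OpenSubgroup G) (s : Finset G), (∀ x ∈ s, x ∈ U) ∧
      ∀ z, U.indicator (fun _ => c) z = ∑ x ∈ s, (x • (H : Set G)).indicator (fun _ => c) z := by
  obtain ⟨H, s, hsU, hpair, hUeq⟩ := exists_finset_eq_biUnion_smul hU
  refine ⟨H, s, hsU, fun z => ?_⟩
  rw [hUeq]
  exact indicator_eq_sum_indicator_smul (H : Subgroup G) s hpair c z

end Summit.Ventures.HodgeRepro2.T5ClopenCosets
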